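import Summits.FinalStateConjecture.FinalStateConjecture.Theses.KillingDefectSpacetimeBound

/-!
# Line `birth` — BC3 skeleton for the crux `BootstrapFromRecurrence` (stmt-FinalStateConjecture-18634)

Route `KillingDefectSpacetimeBound` (route-FinalStateConjecture-KillingDefectSpacetimeBound), crux #6
`Summit.FinalStateConjecture.FinalStateConjecture.Theses.KillingDefectSpacetimeBound.BootstrapFromRecurrence`
(B, the Łojasiewicz–Simon loop): `DefectObservability → DefectCoercivity → SquareIntegrableCapture →
∃ K, every maximal development with complete 𝓘⁺ carrying an order-K hyperboloidal Kerr-star foliation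
with rays, recurrently small leaf deviation d_K and finite outer-zone defect budget of order K+2 settles
as the Statement demands`.

THE CUT (planner, skeleton-register; three registered stubs = the two mechanisms the crux's own
"why it might fail" names, plus the loop that consumes them):

* `stub_localStability : Stmt.stub_localStability` ("LocalStability", LS) — LOCAL CAUCHY STABILITY ON BANDS: on a foliation of order
  `k` with bounds `Λ`, one quiet leaf (`d_k(τ) ≤ ε`) forces a quiet window (`d_k ≤ δ` on `[τ, τ+L]`),
  `ε = ε(k, Λ, χ, M₀, a₀, δ, L)`. Mechanism: continuous dependence for the vacuum equations on the
  domain of dependence of the band (finite for the region `‖y‖ ≲ Λ/δ`; beyond it the LE weight makes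
  the bound automatic from the `C^{k+4}` bounds), re-charting the later bands by transported
  coordinates. Risk #2 of the crux ("recurrent smallness of d_k into smallness on a whole first
  window"); it is ALSO the continuation device of the loop. Size M–L.
* `stub_orderRegain : Stmt.stub_orderRegain` ("OrderRegain", OR) — REGAIN OF TWO ORDERS: on a foliation of order `k+2` (so with
  `C^{k+6}` bounds), `d_{k+2}(τ) ≤ C · d_k(τ)^θ` once `d_k(τ) ≤ δ₁`. Mechanism: Kolmogorov–Landau /
  Gagliardo–Nirenberg interpolation on unit bands (`θ ≤ 2/3`) after smoothing the re-charting
  (near-isometries of bounded-geometry metrics are as regular as the metrics, Calabi–Hartman;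
  Anderson 2004 §5). Risk #1 of the crux ("K3 consumes order k+2 and returns order k"). Size M.
* `stub_loop : Stmt.stub_loop` (`:= DefectObservability → DefectCoercivity → Stmt.stub_localStability →
  Stmt.stub_orderRegain → EventualCapture`)
  — THE LOOP PROPER, provable from its four hypotheses by analysis bookkeeping (no physics left):
  budget tail `defectLE (k+4) (Ioi T) outer → 0`; recurrence + LS give a first quiet
  window `[τ₁, τ₁+L₃]` of K3's length with tail `≤ δ`; on any window inside the quiet range K2 (order
  `k+2`) bounds the middle-zone defect by `C₂ ·` tail and K3 (order `k`) gives
  `d_k² ≤ C₃ (C₂+1) δ =: ρ²` on middle halves; OR + LS at the right end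
  extend the quiet range by `3L₃/4` (induction on windows, no supremum argument); the middle halves of
  the half-overlapping windows tile `[τ₁ + L₃/4, ∞)`, each time lies in ≤ 2 windows, so
  `∫ d_k² ≤ (L₃/4) δ̄² + L₃ C₃ (C₂+1) δ`, the full order-`k+2` defect after `τ₁` is `≤ (C₂+1) δ`
  (continuity of `∫⁻` from below in `τ₂`), and the four hypotheses of K1 at order `k` hold from `τ₁`.
  Size M (in Lean).
* `BootstrapFromRecurrence_of` (sorry-free, pure logic): with `k₀` from the loop and `k₁` from K1 take
  `K := max k₀ k₁ + 2`; B's recurrence is at order `K = k+2`, its budget at order `K+2 = k+4`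
  (definitional), and K1 at order `k` (foliation of order `k` by `IsHypKerrFoliation.of_le`) settles
  the development.

PLANNER'S WARNING (not load-bearing here; recorded for the disprover / tribunal, NOTES.md "Barrier
notes"): `Spacetime.leafDev` takes its infimum over ALL masses `0 < M` and evaluates the LE weight at
the RE-CHARTING's coordinates, which live in `Kerr.region a M ⊆ {‖y‖ > M}`; the τ-preserving radial
rescaling `Φ := Ψ ∘ S_M`, `M → ∞`, appears to be an admissible re-charting with weighted `Cᵏ`
deviation `O(C(k,Λ)/M)`, which would make `leafDev ≡ 0` on every bounded-geometry foliation. If a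
refuter confirms this, every `leafDev ≤ δ` hypothesis of K1/K2/K3/R is vacuous, K3 and the two
`leafDev` stubs below become trivial, and the loop reduces to tail + K2 + K1 — the skeleton stays
valid verbatim, but the route's content migrates into K1/K2 (and into the Ionescu–Klainerman
barrier's scope). The statements below are phrased abstractly in `leafDev` and survive a repair of
its definition (compact mass window / weight in the reference chart).

`sorry` occurs ONLY in the three `stub_*` theorems; their statements are the Props `Stmt.stub_*` (registry
convention: the skeleton theorem's hypotheses are the stubs BY NAME); `BootstrapFromRecurrence_of`
concludes the crux BY NAME and `BootstrapFromRecurrence_proof` is the crux modulo exactly the stubs. Disproof used: none exists for this crux (`ledger crux ls stmt-FinalStateConjecture-18634`: no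
workfiles). Negatives index: the only FinalStateConjecture negative (UniformPhotonSphereChannels) is
not touched — no uniform-in-M constant is claimed (all constants depend on k, Λ, χ, M₀, a₀).
-/

-- `Summit.<Summit>.<Problem>`: for the single-conjunct summit the duplicate component is mandated.
set_option linter.dupNamespace false
set_option linter.unusedVariables false

noncomputable section

namespace Summit.FinalStateConjecture.FinalStateConjecture.Cruxes.BootstrapFromRecurrence.Birth

open Literature.Geometry.Lorentzian MeasureTheory Filter Set
open Summit.FinalStateConjecture.FinalStateConjecture.Theses.KillingDefectSpacetimeBound
open scoped ENNReal Manifold ContDiff Topology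

/-! ## The two mechanisms named by the crux, as Props -/

/-- **Local Cauchy stability on bands** (hypothesis-level Prop of the line). For every order `k`,
bounds `(Λ, χ, M₀, a₀)`, target `δ > 0` and length `L` there is `ε > 0` such that on every
hyperboloidal Kerr-star foliation of order `k` of a vacuum Cauchy development, a leaf `τ ≥ τ₀` with
LE-weighted `Cᵏ` leaf deviation `d_k(τ) ≤ ε` is followed by a whole window `[τ, τ + L]` on which
`d_k ≤ δ`. Continuous dependence on Cauchy data for the vacuum equations in the gauge-invariant
`leafDev` language (Anderson 2004, §5: Cauchy stability in bounded geometry; DHRT arXiv:2104.08222,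
§1). [cite: Anderson2004, §5] -/
def Stmt.stub_localStability : Prop :=
  ∀ (k : ℕ) (Λ χ M₀ a₀ δ L : ℝ), 0 < δ → ∃ ε : ℝ, 0 < ε ∧
    ∀ (X : Type) [TopologicalSpace X] [ChartedSpace E3 X] [IsManifold (𝓡 3) ∞ X] [T2Space X]
      [SecondCountableTopology X] [ConnectedSpace X], ∀ D ∈ admissibleVacuumData X,
      ∀ (𝒟 : VacuumCauchyDevelopment D) (τ₀ : ℝ)
        (Ψ : (Kerr.hypStarBackground M₀ a₀).domain → 𝒟.carrier),
        𝒟.toSpacetime.IsHypKerrFoliation k Λ χ M₀ a₀ τ₀ Ψ →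
          ∀ τ : ℝ, τ₀ ≤ τ → 𝒟.toSpacetime.leafDev M₀ a₀ Ψ χ k τ ≤ ENNReal.ofReal ε →
            ∀ σ ∈ Icc τ (τ + L), 𝒟.toSpacetime.leafDev M₀ a₀ Ψ χ k σ ≤ ENNReal.ofReal δ

/-- **Regain of two orders** (hypothesis-level Prop of the line). For every order `k` and bounds
`(Λ, χ, M₀, a₀)` there are `δ₁ > 0`, `C` and an exponent `θ > 0` such that on every foliation of
order `k + 2` (hence with `C^{k+6}` bounds `Λ` on unit bands) and every leaf `τ ≥ τ₀` with
`d_k(τ) ≤ δ₁` one has `d_{k+2}(τ) ≤ C · d_k(τ)^θ`. Interpolation of the intermediate derivatives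
against the foliation's regularity reserve, after smoothing the re-charting (Anderson 2004, §5,
(5.3)–(5.6); Calabi–Hartman regularity of near-isometries). [cite: Anderson2004, §5 (5.3)–(5.6)] -/
def Stmt.stub_orderRegain : Prop :=
  ∀ (k : ℕ) (Λ χ M₀ a₀ : ℝ), ∃ (δ₁ C θ : ℝ), 0 < δ₁ ∧ 0 < θ ∧
    ∀ (X : Type) [TopologicalSpace X] [ChartedSpace E3 X] [IsManifold (𝓡 3) ∞ X] [T2Space X]
      [SecondCountableTopology X] [ConnectedSpace X], ∀ D ∈ admissibleVacuumData X,
      ∀ (𝒟 : VacuumCauchyDevelopment D) (τ₀ : ℝ)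
        (Ψ : (Kerr.hypStarBackground M₀ a₀).domain → 𝒟.carrier),
        𝒟.toSpacetime.IsHypKerrFoliation (k + 2) Λ χ M₀ a₀ τ₀ Ψ →
          ∀ τ : ℝ, τ₀ ≤ τ → 𝒟.toSpacetime.leafDev M₀ a₀ Ψ χ k τ ≤ ENNReal.ofReal δ₁ →
            𝒟.toSpacetime.leafDev M₀ a₀ Ψ χ (k + 2) τ ≤
              ENNReal.ofReal C * 𝒟.toSpacetime.leafDev M₀ a₀ Ψ χ k τ ^ θ

/-- **Eventual capture hypotheses** (the loop's output = the input of K1 `SquareIntegrableCapture`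
at order `k`, reached from B's hypotheses at order `k + 2`): there is `k₀` such that for `k ≥ k₀`,
all bounds and all `δ₀, η > 0`, every foliation of order `k + 2` with recurrently small `d_{k+2}`
and finite outer-zone defect budget of order `k + 4` admits a time `τ₁ ≥ τ₀` after which
`d_k ≤ δ₀`, `∫ d_k² ≤ η`, the full LE defect of order `k` is `≤ η` and the outer-zone defect of
order `k + 2` is `≤ η`. (Łojasiewicz–Simon convergence scheme: finite dissipation + rigidity
inequality + local stability ⇒ capture; Simon 1983.) [cite: Simon1983, §0] -/
def EventualCapture : Prop :=
  ∃ k₀ : ℕ, ∀ k : ℕ, k₀ ≤ k → ∀ (Λ χ M₀ a₀ δ₀ η : ℝ), 0 < δ₀ → 0 < η →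
    ∀ (X : Type) [TopologicalSpace X] [ChartedSpace E3 X] [IsManifold (𝓡 3) ∞ X] [T2Space X]
      [SecondCountableTopology X] [ConnectedSpace X], ∀ D ∈ admissibleVacuumData X,
      ∀ (𝒟 : VacuumCauchyDevelopment D) (τ₀ : ℝ)
        (Ψ : (Kerr.hypStarBackground M₀ a₀).domain → 𝒟.carrier),
        𝒟.toSpacetime.IsHypKerrFoliation (k + 2) Λ χ M₀ a₀ τ₀ Ψ →
          (∀ ε : ℝ, 0 < ε →
            ∃ᶠ τ in atTop, 𝒟.toSpacetime.leafDev M₀ a₀ Ψ χ (k + 2) τ ≤ ENNReal.ofReal ε) →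
            𝒟.toSpacetime.defectLE (Kerr.hypStarBackground M₀ a₀) Ψ (k + 4) (Ioi τ₀)
                (Kerr.outerZones M₀ a₀) < ⊤ →
              ∃ τ₁ : ℝ, τ₀ ≤ τ₁ ∧
                (∀ τ : ℝ, τ₁ ≤ τ → 𝒟.toSpacetime.leafDev M₀ a₀ Ψ χ k τ ≤ ENNReal.ofReal δ₀) ∧
                ∫⁻ τ in Ioi τ₁, 𝒟.toSpacetime.leafDev M₀ a₀ Ψ χ k τ ^ 2 ≤ ENNReal.ofReal η ∧
                𝒟.toSpacetime.defectLE (Kerr.hypStarBackground M₀ a₀) Ψ k (Ioi τ₁) univ ≤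
                    ENNReal.ofReal η ∧
                𝒟.toSpacetime.defectLE (Kerr.hypStarBackground M₀ a₀) Ψ (k + 2) (Ioi τ₁)
                    (Kerr.outerZones M₀ a₀) ≤ ENNReal.ofReal η

/-- **The loop statement** (`Stmt.stub_loop`): K2 (defect observability) → K3 (defect coercivity) →
LS → OR → `EventualCapture`. A theorem of its four hypotheses (window induction + `∫⁻` bookkeeping);
filed as a stub because it is M-sized in Lean, not because it is in doubt. -/
def Stmt.stub_loop : Prop :=
  DefectObservability → DefectCoercivity → Stmt.stub_localStability → Stmt.stub_orderRegain →
    EventualCapture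

/-! ## The registered stubs -/

/-- **Stub LS — local Cauchy stability on bands** (`Stmt.stub_localStability`). Why plausibly true:
continuous dependence on data for the Einstein vacuum equations on the (finite, by the `Λ`-bounds on `g` and
`g⁻¹`) domain of dependence of the part `‖y‖ ≲ Λ/δ` of the later bands, with the `C^{k+4}` reserve
paying for the derivative loss; far out the LE weight makes `d ≤ δ` automatic. Why it might fail:
the re-charting of the later bands must be ONE smooth injective chart covering the band outside the
deep shell — gluing the stability chart to the reference chart far out needs an isotopy, and the
weighted closeness `ε(1+‖y‖)` degenerates before the automatic regime starts unless `ε ≪ δ²/Λ`.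
Size M–L. [cite: Anderson2004, §5] -/
theorem stub_localStability : Stmt.stub_localStability := by
  sorry

/-- **Stub OR — regain of two orders** (`Stmt.stub_orderRegain`). Why plausibly true: interpolation
`‖D^{k+2}h‖ ≲ ‖h‖_{Cᵏ}^{2/3} ‖h‖_{C^{k+6}}^{1/3}` on unit bands for `h = Φ^*g − g_{M,a}` after
mollifying the near-optimal re-charting `Φ` at scale `d_k^{1/(k+6)}` (its `C^{k+6}` size is then
controlled by `Λ`). Why it might fail: the infimum defining `d_k` may be approached only by
re-chartings whose higher derivatives blow up faster than mollification repairs, or along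
degenerating parameters `(M, a)`. Size M. [cite: Anderson2004, §5 (5.3)–(5.6)] -/
theorem stub_orderRegain : Stmt.stub_orderRegain := by
  sorry

/-- **Stub LOOP — the Łojasiewicz–Simon loop** (`Stmt.stub_loop := K2 → K3 → LS → OR →
EventualCapture`). Why plausibly true: it is a theorem of its four hypotheses (window induction + `∫⁻` bookkeeping, see the
module docstring; constants: `k₀ := max k₂ k₃`, K3's `(δ₀³, L₃, C₃)` at order `k`, K2's `(δ₀², C₂)`
at order `k+2`, OR's `(δ₁, C_R, θ)`, LS at order `k+2` with target
`δ̄ := min (δ₀², δ₀³, δ₀, √(η/L₃))/2` and length `L₃`, then `ρ` with `C_R ρ^θ ≤ ε_LS`, `ρ ≤ δ₁`,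
and the tail level `δ` with `C₃ (C₂+1) δ ≤ ρ²`, `(L₃ C₃ + 1)(C₂ + 1) δ ≤ η/2`). Why it might fail:
only through a mismatch of window conventions (K3 needs the whole window quiet at order `k+2` and
returns order `k` on the middle half — repaired by OR + LS at the right end, progress `3L₃/4 ≥ 3`
per step). Size M (Lean). [cite: Simon1983, §0] [cite: LindbladTohaneanu2020, Thm. 1] -/
theorem stub_loop : Stmt.stub_loop := by
  sorry

/-! ## The composition: the stubs prove the crux BY NAME -/

/-- **THE SKELETON THEOREM.** `Stmt.stub_localStability → Stmt.stub_orderRegain → Stmt.stub_loop →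
BootstrapFromRecurrence` (hypotheses = exactly the registered stubs' statements, by name): take
`K := max k₀ k₁ + 2` (`k₀` from the loop, `k₁` from K1); B's recurrence is the loop's at order
`K = k + 2`, B's budget of order `K + 2` is the loop's of order `k + 4`, and K1 at order `k` — on
the same foliation read at order `k` — settles the development. [cite: Simon1983, §0] -/
theorem BootstrapFromRecurrence_of :
    Stmt.stub_localStability → Stmt.stub_orderRegain → Stmt.stub_loop → BootstrapFromRecurrence := by
  intro hLS hOR hloop h₂ h₃ h₁
  obtain ⟨k₀, hk₀⟩ := hloop h₂ h₃ hLS hOR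
  obtain ⟨k₁, hk₁⟩ := h₁
  refine ⟨max k₀ k₁ + 2, ?_⟩
  intro X _ _ _ _ _ _ D hD 𝒟 hmax hI hfol
  obtain ⟨Λ, χ, M₀, a₀, τ₀, Ψ, hΨ, hrays, hrec, hbud⟩ := hfol
  obtain ⟨δ₀, η, hδ₀, hη, hcap⟩ := hk₁ (max k₀ k₁) (le_max_right _ _) Λ χ M₀ a₀
  obtain ⟨τ₁, hτ₁, hd, hint, hfull, hout⟩ :=
    hk₀ (max k₀ k₁) (le_max_left _ _) Λ χ M₀ a₀ δ₀ η hδ₀ hη X D hD 𝒟 τ₀ Ψ hΨ hrec hbud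
  exact hcap X D hD 𝒟 hmax τ₀ Ψ (hΨ.of_le (Nat.le_add_right _ _)) hrays hI τ₁ hτ₁ hd hint hfull
    hout

/-- **The crux, closed modulo exactly the three registered stubs** (sorries only inside `stub_*`). -/
theorem BootstrapFromRecurrence_proof : BootstrapFromRecurrence :=
  BootstrapFromRecurrence_of stub_localStability stub_orderRegain stub_loop

end Summit.FinalStateConjecture.FinalStateConjecture.Cruxes.BootstrapFromRecurrence.Birth

end
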